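import Literature.NumberTheory.GaloisRepresentations.HomDualReadoutUnramified
import Literature.NumberTheory.EllipticCurves.ZpExtensionEisensteinSelmerStructure
import HarnessLib

/-!
# `H¹` of a bijective equivariant map is bijective and matches the unramified subgroups

Topic `NumberTheory/GaloisRepresentations` (sequel to `HomDualReadoutUnramified` §2 `map_one_injective_of_bijective`).
One definition with body (the inverse intertwining map of a bijective `→ⁱL` between DISCRETE modules) and theorems;
no named fact, no instance, no `sorry`.

* `ContIntertwiningMap.discreteSymm f hf : ρ' →ⁱL ρ` — the inverse of a bijective continuous equivariant map of discrete
  Galois modules (continuity is automatic), `discreteSymm_apply_apply`, `apply_discreteSymm_apply`;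
* `galoisCohomology.map_one_surjective_of_bijective`, **`map_one_bijective_of_bijective`**;
* `galoisCohomology.map_res_comm` (`res_L ∘ H¹(f) = H¹(f|_L) ∘ res_L`, from the tree's `pullback_map_one`) and, over a
  non-archimedean local field, **`map_unramifiedSubgroup_le`** (`H¹(f)(H¹_ur) ≤ H¹_ur`) and
  **`map_unramifiedSubgroup_eq_of_bijective`** (`H¹(f)(H¹_ur(M)) = H¹_ur(M')` for bijective `f`).

WHY (cell `pub/bsd-print-x9`, STUB 1c H.4 local clause): the module isomorphism `Θ : Tw(T_𝔮/p^k) ⥲ (T_𝔮/p^k)^∨(1)`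
(`eisensteinTwistDualMap_bijective`, `DualityDatum.toTateDual`) must carry the unramified local condition of `Tw T` onto
that of `T^∨(1)` so that the tree's `LocalInvariants.UnramifiedOrthogonal` applies. BSD is not proved by any of this.

References: [SerreGaloisCohomology1997] J.-P. Serre, *Galois Cohomology*, I §2.2–2.4 (functoriality, restriction);
[MilneADT2006] I §2 (unramified cohomology).
-/

noncomputable section

open Function
open scoped ContRepresentation

namespace Literature.NumberTheory.GaloisRepresentations

variable {K : Type} [Field K] {M M' : Type} [AddCommGroup M] [TopologicalSpace M] [DiscreteTopology M]
  [AddCommGroup M'] [TopologicalSpace M'] [DiscreteTopology M']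
  {ρ : DiscreteGaloisModule K M} {ρ' : DiscreteGaloisModule K M'}

/-- **The inverse of a bijective equivariant map of discrete Galois modules**, as an intertwining map `ρ' →ⁱL ρ`
(continuity is automatic on discrete modules). [cite: SerreGaloisCohomology1997, I §2.2] -/
def ContIntertwiningMap.discreteSymm (f : ρ.toContRepresentation →ⁱL ρ'.toContRepresentation) (hf : Bijective f) :
    ρ'.toContRepresentation →ⁱL ρ.toContRepresentation where
  toContinuousLinearMap :=
    ⟨((AddEquiv.ofBijective (f : M →+ M') hf).symm : M' →+ M).toIntLinearMap, continuous_of_discreteTopology⟩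
  isIntertwining' σ := by
    refine ContinuousLinearMap.ext fun m' => ?_
    obtain ⟨m, rfl⟩ := hf.2 m'
    have h1 : (AddEquiv.ofBijective (f : M →+ M') hf).symm (f m) = m := (AddEquiv.ofBijective (f : M →+ M') hf).symm_apply_apply m
    have hσ := f.isIntertwining σ m
    change ((AddEquiv.ofBijective (f : M →+ M') hf).symm) (ρ'.toContRepresentation σ (f m)) =
      ρ.toContRepresentation σ ((AddEquiv.ofBijective (f : M →+ M') hf).symm (f m))
    rw [h1]
    change f (ρ.toContRepresentation σ m) = ρ'.toContRepresentation σ (f m) at hσ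
    rw [← hσ]
    exact (AddEquiv.ofBijective (f : M →+ M') hf).symm_apply_apply _

/-- `f⁻¹ (f m) = m`. [cite: SerreGaloisCohomology1997, I §2.2] -/
@[simp]
theorem ContIntertwiningMap.discreteSymm_apply_apply (f : ρ.toContRepresentation →ⁱL ρ'.toContRepresentation)
    (hf : Bijective f) (m : M) : ContIntertwiningMap.discreteSymm f hf (f m) = m :=
  (AddEquiv.ofBijective (f : M →+ M') hf).symm_apply_apply m

/-- `f (f⁻¹ m') = m'`. [cite: SerreGaloisCohomology1997, I §2.2] -/
@[simp]
theorem ContIntertwiningMap.apply_discreteSymm_apply (f : ρ.toContRepresentation →ⁱL ρ'.toContRepresentation)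
    (hf : Bijective f) (m' : M') : f (ContIntertwiningMap.discreteSymm f hf m') = m' :=
  (AddEquiv.ofBijective (f : M →+ M') hf).apply_symm_apply m'

/-- `H¹(f⁻¹) ∘ H¹(f) = id`. [cite: SerreGaloisCohomology1997, I §2.2] -/
theorem galoisCohomology.map_discreteSymm_map (f : ρ.toContRepresentation →ⁱL ρ'.toContRepresentation) (hf : Bijective f)
    (x : galoisCohomology ρ 1) :
    galoisCohomology.map (ContIntertwiningMap.discreteSymm f hf) 1 (galoisCohomology.map f 1 x) = x := by
  obtain ⟨φ, rfl⟩ := oneCocycleClass_surjective _ x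
  rw [galoisCohomology.map_one_oneCocycleClass, galoisCohomology.map_one_oneCocycleClass]
  congr 1
  refine Subtype.ext (ContinuousMap.ext fun g => ?_)
  exact ContIntertwiningMap.discreteSymm_apply_apply f hf _

/-- `H¹(f) ∘ H¹(f⁻¹) = id`. [cite: SerreGaloisCohomology1997, I §2.2] -/
theorem galoisCohomology.map_map_discreteSymm (f : ρ.toContRepresentation →ⁱL ρ'.toContRepresentation) (hf : Bijective f)
    (y : galoisCohomology ρ' 1) :
    galoisCohomology.map f 1 (galoisCohomology.map (ContIntertwiningMap.discreteSymm f hf) 1 y) = y := by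
  obtain ⟨φ, rfl⟩ := oneCocycleClass_surjective _ y
  rw [galoisCohomology.map_one_oneCocycleClass, galoisCohomology.map_one_oneCocycleClass]
  congr 1
  refine Subtype.ext (ContinuousMap.ext fun g => ?_)
  exact ContIntertwiningMap.apply_discreteSymm_apply f hf _

/-- **`H¹(f)` is surjective for a bijective `f`.** [cite: SerreGaloisCohomology1997, I §2.2] -/
theorem galoisCohomology.map_one_surjective_of_bijective (f : ρ.toContRepresentation →ⁱL ρ'.toContRepresentation)
    (hf : Bijective f) : Surjective (galoisCohomology.map f 1) :=
  fun y => ⟨_, galoisCohomology.map_map_discreteSymm f hf y⟩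

/-- **`H¹(f)` is bijective for a bijective `f`.** [cite: SerreGaloisCohomology1997, I §2.2] -/
theorem galoisCohomology.map_one_bijective_of_bijective (f : ρ.toContRepresentation →ⁱL ρ'.toContRepresentation)
    (hf : Bijective f) : Bijective (galoisCohomology.map f 1) :=
  ⟨galoisCohomology.map_one_injective_of_bijective f hf, galoisCohomology.map_one_surjective_of_bijective f hf⟩

/-! ## Unramified subgroups -/

section Unramified

variable {F : Type} [Field F] [ValuativeRel F]
  {W W' : Type} [AddCommGroup W] [TopologicalSpace W] [DiscreteTopology W]
  [AddCommGroup W'] [TopologicalSpace W'] [DiscreteTopology W']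
  {τ : DiscreteGaloisModule F W} {τ' : DiscreteGaloisModule F W'}

/-- **`H¹(f)` maps unramified classes to unramified classes** (restriction to `F^{ur}` commutes with `H¹(f)`, tree
`pullback_map_one`). [cite: MilneADT2006, Ch. I §2 (unramified cohomology)] -/
theorem galoisCohomology.map_unramifiedSubgroup_le (f : τ.toContRepresentation →ⁱL τ'.toContRepresentation) :
    (τ.unramifiedSubgroup 1).map (galoisCohomology.map f 1) ≤ τ'.unramifiedSubgroup 1 := by
  rintro _ ⟨x, hx, rfl⟩
  rw [SetLike.mem_coe, DiscreteGaloisModule.mem_unramifiedSubgroup_iff] at hx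
  rw [DiscreteGaloisModule.mem_unramifiedSubgroup_iff]
  change galoisCohomology.pullback τ' _ 1 (galoisCohomology.map f 1 x) = 0
  rw [Literature.NumberTheory.EllipticCurves.DiscreteGaloisModule.pullback_map_one f _ x]
  change galoisCohomology.map _ 1 (galoisCohomology.res τ _ 1 x) = 0
  rw [hx, map_zero]

/-- **`H¹(f)(H¹_ur(W)) = H¹_ur(W')` for a bijective `f`** (apply the inclusion to `f` and to `f⁻¹`).
[cite: MilneADT2006, Ch. I §2 (unramified cohomology)] -/
theorem galoisCohomology.map_unramifiedSubgroup_eq_of_bijective (f : τ.toContRepresentation →ⁱL τ'.toContRepresentation)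
    (hf : Bijective f) :
    (τ.unramifiedSubgroup 1).map (galoisCohomology.map f 1) = τ'.unramifiedSubgroup 1 := by
  refine le_antisymm (galoisCohomology.map_unramifiedSubgroup_le f) fun y hy => ?_
  refine ⟨galoisCohomology.map (ContIntertwiningMap.discreteSymm f hf) 1 y, ?_, galoisCohomology.map_map_discreteSymm f hf y⟩
  exact galoisCohomology.map_unramifiedSubgroup_le (ContIntertwiningMap.discreteSymm f hf) ⟨y, hy, rfl⟩

end Unramified

end Literature.NumberTheory.GaloisRepresentations
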